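import Literature.AlgebraicGeometry.HodgeTheory.SurjectivePushPullSplitting
import Literature.AlgebraicGeometry.HodgeTheory.SurjectiveMorphismBettiHodgeNumbers
import Literature.AlgebraicGeometry.HodgeTheory.HodgeNumbersHardLefschetzDuality
import Literature.AlgebraicGeometry.HodgeTheory.ComplexGysinHodgeType
import HarnessLib

/-!
# The push–pull splitting `Hᵏ(X) = g^* Hᵏ(W) ⊕ ker(g_* Lʳ_η)` respects Hodge types:
# `H^{p,q}(X) = g^* H^{p,q}(W) ⊕ (H^{p,q}(X) ∩ ker(g_* Lʳ_η))`, `h^{p,q}(X) = h^{p,q}(W) + …`,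
# `b_k(X) = b_k(W) + dim ker(g_* Lʳ_η)`, and the trace identity `∫_X ηʳ ∪ g^*θ = c ∫_W θ`

Family `hodge`, layer `Literature/AlgebraicGeometry/HodgeTheory`; lane `lit-hodgefound` (Track 2 foundations,
Layer A1). THEOREMS ONLY (no definition, no named fact; D-0026).

Voisin I §7.3.2 (p. 150): «the morphism `φ^*` is a morphism of Hodge structures», Lemma 7.28 (`φ^*`
injective for `φ` surjective, `X` compact Kähler) and Remark 7.29 (`φ_* φ^* = deg φ · Id`); the Gysin
morphism `φ_*` is a morphism of Hodge structures of bidegree `(−r, −r)`, `r = dim X − dim Y` (§7.3.2 with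
Lemma 7.30; the tree's `isOfHodgeType_complexGysin_of_cupPreservesHodgeType`), and `L_η` has bidegree
`(1, 1)` (§6.2.3 Rem. 6.27; the tree's `KaehlerRationalDatum.isOfHodgeType_lefschetzPowTo`). With the
tree's splitting along a SURJECTIVE `g : X ⟶ W` of smooth projective complex varieties, `dim X = dim W + r`,
`η = D.Hη` the rational Kähler class of a Kähler–rational datum `D` of `X`
(`SurjectivePushPullSplitting`: `g_*(Lʳ_η(g^* α)) = c • α`, `c ≠ 0`;
`Hᵏ(X) = g^* Hᵏ(W) ⊕ ker(g_* ∘ Lʳ_η)`), this file proves: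

* §1 **`KaehlerRationalDatum.isOfHodgeType_complexGysin_lefschetzPow`** — `g_* ∘ Lʳ_η : Hᵏ(X) → Hᵏ(W)` preserves
  the Hodge type `(p, q)` (ANY morphism `g` with `dim X = dim W + r`); `HodgeModel.map_typePiece_complexGysin_lefschetzPow_le`
  (type pieces of Hodge models).
* §2 (surjective `g`) `HodgeModel.map_typePiece_complexGysin_lefschetzPow_eq` (`g_* Lʳ_η` maps `H^{p,q}_B(X)` ONTO
  `H^{p,q}_A(W)`), **`HodgeModel.typePiece_eq_map_sup_inf_ker`** and `HodgeModel.disjoint_map_typePiece_inf_ker`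
  — `H^{p,q}_B(X) = g^* H^{p,q}_A(W) ⊕ (H^{p,q}_B(X) ∩ ker(g_* Lʳ_η))` for all Hodge models `A` of `W`, `B` of `X`.
* §3 numerics: **`HodgeModel.finrank_typePiece_eq_add_of_surjective`** and the model-free
  **`BettiUniverse.hodgeNumber_hodge_eq_add_of_surjective`** (`h^{p,q}(X) = h^{p,q}(W) + dim(H^{p,q}_B(X) ∩ ker(g_* Lʳ_η))`),
  **`KaehlerRationalDatum.finrank_complexBetti_eq_add_finrank_ker`** (`dim Hᵏ(X(ℂ);ℂ) = dim Hᵏ(W(ℂ);ℂ) + dim ker(g_* Lʳ_η)`,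
  rank–nullity for the surjective `g_* Lʳ_η`) and `…finrank_bettiCohomology_eq_add_finrank_ker` (`b_k`).
* §4 the trace identity **`KaehlerRationalDatum.traceC_cupProduct_lefschetzPow_one_map`**:
  `∫_X Lʳ_η 1 ∪ g^* θ = c · ∫_W θ` for `θ ∈ H^{2 dim W}(W(ℂ); ℂ)` and the scalar `c` of `g_*(Lʳ_η 1) = c • 1`
  (projection formula through the trace); for `r = 0` this is `∫_X φ^*θ = deg φ ∫_Y θ`.

## References

* [Voisin2002] [VoisinHodgeI2002] C. Voisin, Hodge Theory and Complex Algebraic Geometry I, CUP 2002,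
  §6.2.3 Rem. 6.27; §7.1.1–7.1.2; §7.3.2 (p. 150), Lemma 7.28, Remark 7.29, Lemma 7.30.
* [FultonYoungTableaux1997] W. Fulton, Young Tableaux, CUP 1997, Appendix B §B.1 (5)–(6).
* [HatcherAT2002] A. Hatcher, Algebraic Topology, CUP 2002, §3.1 Thm. 3.2, §3.A Cor. 3A.6.
* [Kahn2020] B. Kahn, Zeta and L-functions of varieties and motives, CUP 2020, §6.9 Lemma 6.30 (2).
-/

noncomputable section

open CategoryTheory AlgebraicGeometry Module Finset
open Literature.AlgebraicTopology.SingularHomology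
open Literature.Geometry.Kaehler

namespace Literature.AlgebraicGeometry.HodgeTheory

open Literature.AlgebraicGeometry.Motives
open Literature.AlgebraicGeometry.Motives.HodgeStructure

variable {n m : ℕ} {X W : SchemeOver ℂ}

/-! ### §1 `g_* ∘ Lʳ_η` preserves Hodge types (any `g`) -/

namespace KaehlerRationalDatum

variable (D : KaehlerRationalDatum n X)

/-- **`g_* ∘ Lʳ_η : Hᵏ(X(ℂ); ℂ) → Hᵏ(W(ℂ); ℂ)` is a morphism of Hodge structures of bidegree `(0, 0)`**
for every morphism `g : X ⟶ W` of smooth projective complex varieties with `dim X = dim W + r` and the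
rational Kähler class `η = D.Hη` of a Kähler–rational datum of `X`: `Lʳ_η` raises types by `(r, r)`
(`isOfHodgeType_lefschetzPowTo`) and the Gysin morphism `g_*` lowers them by `(r, r)`
(`isOfHodgeType_complexGysin_of_cupPreservesHodgeType`, Voisin I §7.3.2 / Lemma 7.30).
[cite: VoisinHodgeI2002, §7.3.2 (with Lemma 7.30)] [cite: VoisinHodgeI2002, §6.2.3 Rem. 6.27] -/
theorem isOfHodgeType_complexGysin_lefschetzPow (hX : IsSmoothProjective n X) (hW : IsSmoothProjective m W)
    (g : X ⟶ W) {r : ℕ} (hr : m + r = n) {k p q : ℕ} {x : complexBetti X k}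
    (hx : IsOfHodgeType n X k p q x) :
    IsOfHodgeType m W k p q
      (complexGysin complexOrientationFamily hX hW g (show (k + 2 * r) + 2 * m = k + 2 * n by omega)
        (lefschetzPow D.Hη r k x)) := by
  obtain ⟨A⟩ := nonempty_hodgeModel_holds (n := m) (X := W) hW
  have hL : IsOfHodgeType n X (k + 2 * r) (p + r) (q + r) (lefschetzPow D.Hη r k x) := by
    rw [← lefschetzPowTo_eq_lefschetzPow]
    exact D.isOfHodgeType_lefschetzPowTo hX r k (k + 2 * r) rfl p q x hx
  exact isOfHodgeType_complexGysin_of_cupPreservesHodgeType hodgePQ_independent_of_hodgeModel_holds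
    complexOrientationFamily hX hW D.B A (cupPreservesHodgeType_of_hodgeModel hX D.B)
    (cupPreservesHodgeType_of_hodgeModel hW A) g _ (by omega) (by omega) hL

end KaehlerRationalDatum

/-- **`g_* Lʳ_η` maps the type piece `H^{p,q}_B(X)` into `H^{p,q}_A(W)`** for all Hodge models `A` of
`W`, `B` of `X` (any `g : X ⟶ W`, `dim X = dim W + r`). [cite: VoisinHodgeI2002, §7.3.2 (with Lemma 7.30)] -/
theorem HodgeModel.map_typePiece_complexGysin_lefschetzPow_le (B : HodgeModel n X) (A : HodgeModel m W)
    (D : KaehlerRationalDatum n X) (hX : IsSmoothProjective n X) (hW : IsSmoothProjective m W)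
    (g : X ⟶ W) {r : ℕ} (hr : m + r = n) (k : ℕ) (pq : ↥(Finset.HasAntidiagonal.antidiagonal k)) :
    (B.typePiece k pq).map
        (complexGysin complexOrientationFamily hX hW g (show (k + 2 * r) + 2 * m = k + 2 * n by omega) ∘ₗ
          lefschetzPow D.Hη r k) ≤ A.typePiece k pq := by
  rintro _ ⟨x, hx, rfl⟩
  rw [SetLike.mem_coe, B.mem_typePiece_iff_isOfHodgeType' hX] at hx
  rw [A.mem_typePiece_iff_isOfHodgeType' hW, LinearMap.comp_apply]
  exact D.isOfHodgeType_complexGysin_lefschetzPow hX hW g hr hx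

/-! ### §2 Surjective `g`: the splitting of the type pieces -/

section Surjective

/-- **`g_* Lʳ_η` maps `H^{p,q}_B(X)` ONTO `H^{p,q}_A(W)` along a surjection** (`a = g_* Lʳ_η (c⁻¹ g^* a)`
with `g^* a ∈ H^{p,q}_B(X)`). [cite: Voisin2002, §7.3.2 Lemma 7.28 and Remark 7.29]
[cite: VoisinHodgeI2002, §7.3.2 (p. 150, «φ^* is a morphism of Hodge structures»)] -/
theorem HodgeModel.map_typePiece_complexGysin_lefschetzPow_eq (B : HodgeModel n X) (A : HodgeModel m W)
    (D : KaehlerRationalDatum n X) (hX : IsSmoothProjective n X) (hW : IsSmoothProjective m W) (g : X ⟶ W)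
    [Surjective g.left] {r : ℕ} (hr : m + r = n) (k : ℕ)
    (pq : ↥(Finset.HasAntidiagonal.antidiagonal k)) :
    (B.typePiece k pq).map
        (complexGysin complexOrientationFamily hX hW g (show (k + 2 * r) + 2 * m = k + 2 * n by omega) ∘ₗ
          lefschetzPow D.Hη r k) = A.typePiece k pq := by
  refine le_antisymm (B.map_typePiece_complexGysin_lefschetzPow_le A D hX hW g hr k pq) fun a ha ↦ ?_
  obtain ⟨c, hc0, hc⟩ := D.exists_complexGysin_lefschetzPow_map_eq_smul_of_surjective hX hW g hr
  refine ⟨c⁻¹ • complexBetti.map g k a, Submodule.smul_mem _ _ ?_, ?_⟩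
  · exact A.map_typePiece_le_typePiece B hW hX g k pq (Submodule.mem_map_of_mem ha)
  · simp only [LinearMap.comp_apply, map_smul, hc, smul_smul, inv_mul_cancel₀ hc0, one_smul]

/-- **`g^* H^{p,q}_A(W)` and `H^{p,q}_B(X) ∩ ker(g_* Lʳ_η)` are disjoint** (inside `g^* Hᵏ(W) ∩ ker = 0`,
`KaehlerRationalDatum.isCompl_range_map_ker_complexGysin_lefschetzPow`).
[cite: Voisin2002, §7.3.2 Lemma 7.28 and Remark 7.29] -/
theorem HodgeModel.disjoint_map_typePiece_inf_ker (A : HodgeModel m W) (B : HodgeModel n X)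
    (D : KaehlerRationalDatum n X) (hX : IsSmoothProjective n X) (hW : IsSmoothProjective m W) (g : X ⟶ W)
    [Surjective g.left] {r : ℕ} (hr : m + r = n) (k : ℕ)
    (pq : ↥(Finset.HasAntidiagonal.antidiagonal k)) :
    Disjoint ((A.typePiece k pq).map (complexBetti.map g k).hom)
      (B.typePiece k pq ⊓ LinearMap.ker
        (complexGysin complexOrientationFamily hX hW g (show (k + 2 * r) + 2 * m = k + 2 * n by omega) ∘ₗ
          lefschetzPow D.Hη r k)) :=
  (D.isCompl_range_map_ker_complexGysin_lefschetzPow hX hW g hr k).disjoint.mono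
    LinearMap.map_le_range inf_le_right

/-- **The type pieces split along a surjection: `H^{p,q}_B(X) = g^* H^{p,q}_A(W) ⊔ (H^{p,q}_B(X) ∩ ker(g_* Lʳ_η))`**
(with the two summands disjoint, `disjoint_map_typePiece_inf_ker`): every `x ∈ H^{p,q}_B(X)` is
`c⁻¹ g^*(g_* Lʳ_η x) + (x − c⁻¹ g^*(g_* Lʳ_η x))`, the first summand in `g^* H^{p,q}_A(W)` (§1 and «`φ^*` is a
morphism of Hodge structures»), the second in `H^{p,q}_B(X) ∩ ker(g_* Lʳ_η)` (`g_* Lʳ_η g^* = c · id`). Both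
summands are sub-Hodge structures: `Hᵏ(W)` is a direct summand of `Hᵏ(X)` AS A HODGE STRUCTURE.
[cite: Voisin2002, §7.3.2 Lemma 7.28 and Remark 7.29] [cite: VoisinHodgeI2002, §7.3.2 (p. 150) and Lemma 7.30]
[cite: Kahn2020, §6.9 Lemma 6.30 (2)] -/
theorem HodgeModel.typePiece_eq_map_sup_inf_ker (B : HodgeModel n X) (A : HodgeModel m W)
    (D : KaehlerRationalDatum n X) (hX : IsSmoothProjective n X) (hW : IsSmoothProjective m W) (g : X ⟶ W)
    [Surjective g.left] {r : ℕ} (hr : m + r = n) (k : ℕ)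
    (pq : ↥(Finset.HasAntidiagonal.antidiagonal k)) :
    B.typePiece k pq =
      (A.typePiece k pq).map (complexBetti.map g k).hom ⊔
        (B.typePiece k pq ⊓ LinearMap.ker
          (complexGysin complexOrientationFamily hX hW g (show (k + 2 * r) + 2 * m = k + 2 * n by omega) ∘ₗ
            lefschetzPow D.Hη r k)) := by
  obtain ⟨c, hc0, hc⟩ := D.exists_complexGysin_lefschetzPow_map_eq_smul_of_surjective hX hW g hr
  set P := complexGysin complexOrientationFamily hX hW g
    (show (k + 2 * r) + 2 * m = k + 2 * n by omega) ∘ₗ lefschetzPow D.Hη r k with hP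
  have hPg : ∀ α : complexBetti W k, P (complexBetti.map g k α) = c • α := fun α ↦ by
    rw [hP, LinearMap.comp_apply, hc]
  refine le_antisymm (fun x hx ↦ ?_)
    (sup_le (A.map_typePiece_le_typePiece B hW hX g k pq) inf_le_left)
  -- `P x ∈ H^{p,q}_A(W)`, `g^*(P x) ∈ H^{p,q}_B(X)`
  have hPx : P x ∈ A.typePiece k pq :=
    B.map_typePiece_complexGysin_lefschetzPow_le A D hX hW g hr k pq (Submodule.mem_map_of_mem hx)
  have hgPx : complexBetti.map g k (P x) ∈ B.typePiece k pq :=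
    A.map_typePiece_le_typePiece B hW hX g k pq (Submodule.mem_map_of_mem hPx)
  have hdec : x = c⁻¹ • complexBetti.map g k (P x) + (x - c⁻¹ • complexBetti.map g k (P x)) := by abel
  rw [hdec]
  refine Submodule.add_mem_sup (Submodule.smul_mem _ _ (Submodule.mem_map_of_mem hPx)) ⟨?_, ?_⟩
  · exact Submodule.sub_mem _ hx (Submodule.smul_mem _ _ hgPx)
  · change P (x - c⁻¹ • complexBetti.map g k (P x)) = 0
    rw [map_sub, map_smul, hPg, smul_smul, inv_mul_cancel₀ hc0, one_smul, sub_self]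

/-! ### §3 Numerics: `h^{p,q}(X) = h^{p,q}(W) + …`, `b_k(X) = b_k(W) + dim ker(g_* Lʳ_η)` -/

/-- **`dim H^{p,q}_B(X) = dim H^{p,q}_A(W) + dim(H^{p,q}_B(X) ∩ ker(g_* Lʳ_η))`** along a surjection
(the splitting of §2; `g^*` is injective, Lemma 7.28). [cite: Voisin2002, §7.3.2 Lemma 7.28 and Remark 7.29] -/
theorem HodgeModel.finrank_typePiece_eq_add_of_surjective (B : HodgeModel n X) (A : HodgeModel m W)
    (D : KaehlerRationalDatum n X) (hX : IsSmoothProjective n X) (hW : IsSmoothProjective m W) (g : X ⟶ W)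
    [Surjective g.left] {r : ℕ} (hr : m + r = n) (k : ℕ)
    (pq : ↥(Finset.HasAntidiagonal.antidiagonal k)) :
    Module.finrank ℂ (B.typePiece k pq) =
      Module.finrank ℂ (A.typePiece k pq) +
        Module.finrank ℂ ↥(B.typePiece k pq ⊓ LinearMap.ker
          (complexGysin complexOrientationFamily hX hW g (show (k + 2 * r) + 2 * m = k + 2 * n by omega) ∘ₗ
            lefschetzPow D.Hη r k)) := by
  haveI := finite_complexBetti hX k
  have hsplit := B.typePiece_eq_map_sup_inf_ker A D hX hW g hr k pq
  have hdisj := A.disjoint_map_typePiece_inf_ker B D hX hW g hr k pq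
  have hdim := Submodule.finrank_sup_add_finrank_inf_eq
    ((A.typePiece k pq).map (complexBetti.map g k).hom)
    (B.typePiece k pq ⊓ LinearMap.ker
      (complexGysin complexOrientationFamily hX hW g (show (k + 2 * r) + 2 * m = k + 2 * n by omega) ∘ₗ
        lefschetzPow D.Hη r k))
  have hmap : Module.finrank ℂ (A.typePiece k pq) =
      Module.finrank ℂ ((A.typePiece k pq).map (complexBetti.map g k).hom) :=
    (Submodule.equivMapOfInjective _ (complexBetti_map_injective_of_surjective hW hX g k) _).finrank_eq
  rw [hdisj.eq_bot, finrank_bot, add_zero, ← hsplit, ← hmap] at hdim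
  exact hdim

/-- **`h^{p,q}(X) = h^{p,q}(W) + dim(H^{p,q}_B(X) ∩ ker(g_* Lʳ_η))`** for the lane's model-free Hodge numbers
of `Hᵏ(X)`, `Hᵏ(W)` (`p + q = k`), along a surjective `g : X ⟶ W` with `dim X = dim W + r`, any Hodge model
`B` of `X` and Kähler–rational datum `D` of `X` — refining `h^{p,q}(W) ≤ h^{p,q}(X)`
(`BettiUniverse.hodgeNumber_hodge_le_of_surjective`). [cite: Voisin2002, §7.3.2 Lemma 7.28 and Remark 7.29]
[cite: VoisinHodgeI2002, §7.3.2 (p. 150) and Lemma 7.30] -/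
theorem BettiUniverse.hodgeNumber_hodge_eq_add_of_surjective (hHD : exists_isReal_hodgeModel)
    (B : HodgeModel n X) (D : KaehlerRationalDatum n X) (hX : IsSmoothProjective n X)
    (hW : IsSmoothProjective m W) (g : X ⟶ W) [Surjective g.left] {r : ℕ} (hr : m + r = n) {k p q : ℕ}
    (hpq : p + q = k) :
    (BettiUniverse.hodge hHD hX k).hodgeNumber p q =
      (BettiUniverse.hodge hHD hW k).hodgeNumber p q +
        Module.finrank ℂ ↥(B.typePiece k ⟨(p, q), Finset.HasAntidiagonal.mem_antidiagonal.2 hpq⟩ ⊓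
          LinearMap.ker
            (complexGysin complexOrientationFamily hX hW g (show (k + 2 * r) + 2 * m = k + 2 * n by omega) ∘ₗ
              lefschetzPow D.Hη r k)) := by
  obtain ⟨A⟩ := nonempty_hodgeModel_holds (n := m) (X := W) hW
  rw [BettiUniverse.hodgeNumber_hodge_eq_finrank_typePiece hHD hX B hpq,
    BettiUniverse.hodgeNumber_hodge_eq_finrank_typePiece hHD hW A hpq]
  exact B.finrank_typePiece_eq_add_of_surjective A D hX hW g hr k _

end Surjective

namespace KaehlerRationalDatum

variable (D : KaehlerRationalDatum n X)

/-- **`dim_ℂ Hᵏ(X(ℂ); ℂ) = dim_ℂ Hᵏ(W(ℂ); ℂ) + dim ker(g_* ∘ Lʳ_η)`** along a surjection `g : X ⟶ W`,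
`dim X = dim W + r` (rank–nullity for the SURJECTIVE `g_* Lʳ_η : Hᵏ(X) → Hᵏ(W)`,
`complexGysin_comp_lefschetzPow_surjective`; equivalently the splitting `Hᵏ(X) = g^*Hᵏ(W) ⊕ ker`).
[cite: Voisin2002, §7.3.2 Lemma 7.28 and Remark 7.29] -/
theorem finrank_complexBetti_eq_add_finrank_ker (hX : IsSmoothProjective n X) (hW : IsSmoothProjective m W)
    (g : X ⟶ W) [Surjective g.left] {r : ℕ} (hr : m + r = n) (k : ℕ) :
    Module.finrank ℂ (complexBetti X k) =
      Module.finrank ℂ (complexBetti W k) +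
        Module.finrank ℂ ↥(LinearMap.ker
          (complexGysin complexOrientationFamily hX hW g (show (k + 2 * r) + 2 * m = k + 2 * n by omega) ∘ₗ
            lefschetzPow D.Hη r k)) := by
  haveI := finite_complexBetti hX k
  set P := complexGysin complexOrientationFamily hX hW g
    (show (k + 2 * r) + 2 * m = k + 2 * n by omega) ∘ₗ lefschetzPow D.Hη r k with hP
  have hsurj : Function.Surjective P := fun α ↦ by
    obtain ⟨x, hx⟩ := D.complexGysin_comp_lefschetzPow_surjective hX hW g hr k α
    exact ⟨x, by rw [hP, LinearMap.comp_apply]; exact hx⟩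
  rw [← LinearMap.finrank_range_add_finrank_ker P, LinearMap.range_eq_top.2 hsurj, finrank_top]

/-- **`b_k(X) = b_k(W) + dim_ℂ ker(g_* ∘ Lʳ_η)`** (rational Betti numbers; universal coefficients
`dim_ℂ Hᵏ(−; ℂ) = dim_ℚ Hᵏ(−; ℚ)`, `finrank_complexBetti_eq_finrank_bettiCohomology`).
[cite: Voisin2002, §7.3.2 Lemma 7.28 and Remark 7.29] [cite: HatcherAT2002, §3.1 Thm. 3.2 and §3.A Cor. 3A.6] -/
theorem finrank_bettiCohomology_eq_add_finrank_ker (hX : IsSmoothProjective n X)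
    (hW : IsSmoothProjective m W) (g : X ⟶ W) [Surjective g.left] {r : ℕ} (hr : m + r = n) (k : ℕ) :
    Module.finrank ℚ (bettiCohomology X k) =
      Module.finrank ℚ (bettiCohomology W k) +
        Module.finrank ℂ ↥(LinearMap.ker
          (complexGysin complexOrientationFamily hX hW g (show (k + 2 * r) + 2 * m = k + 2 * n by omega) ∘ₗ
            lefschetzPow D.Hη r k)) := by
  rw [← finrank_complexBetti_eq_finrank_bettiCohomology X k, ← finrank_complexBetti_eq_finrank_bettiCohomology W k]
  exact D.finrank_complexBetti_eq_add_finrank_ker hX hW g hr k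

/-! ### §4 The trace identity `∫_X Lʳ_η 1 ∪ g^* θ = c · ∫_W θ` -/

/-- **`∫_X Lʳ_η 1 ∪ g^* θ = c · ∫_W θ`** for every `θ ∈ H^{2 dim W}(W(ℂ); ℂ)`, any morphism `g : X ⟶ W`
with `dim X = dim W + r`, any `η ∈ H²(X(ℂ); ℂ)` and the scalar `c` with `g_*(Lʳ_η 1_X) = c • 1_W`: the
projection formula through the trace, `∫_X Lʳ_η 1 ∪ g^*θ = ∫_W g_*(Lʳ_η 1) ∪ θ` (`traceC_cup_complexGysin`,
Fulton App. B (5)–(6)). For `r = 0` and `g` generically finite, `c = deg g`: `∫_X φ^*θ = deg φ · ∫_Y θ`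
(Voisin I Rem. 7.29). [cite: Voisin2002, §7.3.2 Lemma 7.28 and Remark 7.29]
[cite: FultonYoungTableaux1997, Appendix B §B.1 (5)–(6)] -/
theorem _root_.Literature.AlgebraicGeometry.HodgeTheory.traceC_cupProduct_lefschetzPow_one_map
    (hX : IsSmoothProjective n X) (hW : IsSmoothProjective m W) (g : X ⟶ W) {r : ℕ} (hr : m + r = n)
    (η : complexBetti X 2) {c : ℂ}
    (hc : complexGysin complexOrientationFamily hX hW g (show (0 + 2 * r) + 2 * m = 0 + 2 * n by omega)
      (lefschetzPow η r 0 (singularCohomology.one ℂ (ComplexPoints X))) =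
      c • singularCohomology.one ℂ (ComplexPoints W))
    (θ : complexBetti W (2 * m)) :
    traceC hX (cupProduct (show (0 + 2 * r) + 2 * m = 2 * n by omega)
      (lefschetzPow η r 0 (singularCohomology.one ℂ (ComplexPoints X))) (complexBetti.map g (2 * m) θ)) =
      c * traceC hW θ := by
  rw [← traceC_cup_complexGysin hX hW g (show (0 + 2 * r) + 2 * m = 0 + 2 * n by omega)
    (show (0 + 2 * r) + 2 * m = 2 * n by omega) (show 0 + 2 * m = 2 * m by omega), hc, map_smul,
    LinearMap.smul_apply, one_cupProduct, map_smul, smul_eq_mul]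

/-- **`∫_X Lʳ_η 1 ∪ g^* θ = c · ∫_W θ` with `c ≠ 0` along a SURJECTIVE `g`**, `η = D.Hη` the rational
Kähler class of a Kähler–rational datum: the scalar `c` of
`exists_complexGysin_lefschetzPow_map_eq_smul_of_surjective` (Voisin I Lemma 7.28 with the wedge kept:
`∫_X φ^*θ ∧ ωʳ ≠ 0`). [cite: Voisin2002, §7.3.2 Lemma 7.28 and Remark 7.29]
[cite: FultonYoungTableaux1997, Appendix B §B.1 (5)–(6)] -/
theorem exists_traceC_cupProduct_lefschetzPow_one_map_eq_mul_of_surjective (hX : IsSmoothProjective n X)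
    (hW : IsSmoothProjective m W) (g : X ⟶ W) [Surjective g.left] {r : ℕ} (hr : m + r = n) :
    ∃ c : ℂ, c ≠ 0 ∧ ∀ θ : complexBetti W (2 * m),
      traceC hX (cupProduct (show (0 + 2 * r) + 2 * m = 2 * n by omega)
        (lefschetzPow D.Hη r 0 (singularCohomology.one ℂ (ComplexPoints X))) (complexBetti.map g (2 * m) θ)) =
        c * traceC hW θ := by
  obtain ⟨c, hc⟩ := exists_eq_smul_one complexOrientationFamily hW
    (complexGysin complexOrientationFamily hX hW g (show (0 + 2 * r) + 2 * m = 0 + 2 * n by omega)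
      (lefschetzPow D.Hη r 0 (singularCohomology.one ℂ (ComplexPoints X))))
  have hc0 : c ≠ 0 := by
    rintro rfl
    exact D.complexGysin_lefschetzPow_one_ne_zero_of_surjective hX hW g hr (by rw [hc, zero_smul])
  exact ⟨c, hc0, fun θ ↦ traceC_cupProduct_lefschetzPow_one_map hX hW g hr D.Hη hc θ⟩

end KaehlerRationalDatum

end Literature.AlgebraicGeometry.HodgeTheory

end
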